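/-
Copyright (c) 2026 the pub-hodgecm-mathlib formalisation cell (harness21).  Prover seat hodgecm-mathlib-F0P2-p11 (g0) (L1 re-deal s1969∕s1970; #41 TOP surface (u-1a) named by
K2E5-p17 (g8) 2026-09-04T15:37Z «natural owner F0P2-p11»), Track B «K2-LIT» ∕ hLiu418 #184♮, ROAD Φ, G5-b = Φ7-3: THE RANK-ONE (KIND 1) TERM PACKAGES OF THE #41 TOP,
INSTANTIATED from ★ p861061 `exists_rankOne_package_cleared_of_termData` — hypothesis-first on the (R1-α)∕(R1-β)∕(R1-γ)∕(T4) identification letters.  THEOREMS ONLY.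
-/
import Summits.HodgeConjecture.HodgeConjecture.Theorems.K2LiuSiegelEisensteinRankOneTermPackageCleared   -- ★ p861061 (γ′) cleared + termData instances
import Summits.HodgeConjecture.HodgeConjecture.Theorems.K2LiuContinuationPackageAlgebra                    -- ★ `exists_height_floor`
import Summits.HodgeConjecture.HodgeConjecture.Theorems.K2LiuSiegelUnipotentFourierDefs                    -- ★ Φ1 (D) `fourierCoeffDelta`, `skewMatrices`
import Summits.HodgeConjecture.HodgeConjecture.Theorems.K2LiuUnipotentCoveringWeight                       -- ★ `exists_isCoveringWeight_unipDeltaRat_lintegral_ne_top`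
import Summits.HodgeConjecture.HodgeConjecture.Theorems.K2LiuUnipotentCocompact                            -- ★ (C0) `exists_isCompact_cover_unipDelta`
import Summits.HodgeConjecture.HodgeConjecture.Theorems.K2LiuUnipDeltaConjMeasurePreserving                -- ★ `lintegral_ne_zero_of_isCoveringWeight`
import Summits.HodgeConjecture.HodgeConjecture.Theorems.K2LiuSiegelUnipotentHaarPinned                     -- ★ `locallyCompactSpace_unipDelta`
import Literature.NumberTheory.Automorphic.AdelicHeightGLSiegel                                              -- ★ `exists_adelicHeightGL_le_of_isCompact`
import Literature.NumberTheory.Automorphic.AdelicHeightGLProofs                                              -- ★ `adelicHeightGL_pos_holds`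
import HarnessLib

/-!
# Crux `HLiu418`, socket #41, KIND 1: THE RANK-ONE TERM PACKAGES `Ec₁ S` OF THE TOP (edition 3), INSTANTIATED — `h1off`, `hd₁`, `hc₁`, `hcoef₁` from ★ p861061 at `X := H(𝔸)`

Cell `hodgecm-mathlib`, crux item hLiu418 = `stmt-HodgeConjecture-24832` (helper lane, count-neutral); squad K2 ∕ K2Liu, LEAD F0P6-plan (g14), desk = #41 TOP author K2E5-p17 (g8);
prover F0P2-p11 (g0).  THEOREMS ONLY (no `def`, no `instance`, no notation, no named-fact hypothesis, no `sorry`).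

WHAT.  ★ #41 TOP edition 3 `K2LiuSiegelEisensteinContinuationTopKinds.siegelEisensteinContinuation_of_kinds` (and 3b `…_fixedCarrier`) takes the RANK-ONE kind as a family
`Ec₁ : skewMatrices c T_L → ℂ → H(𝔸) → ℂ` with the letters `h1off` (zero unless `S ≠ 0 ∧ det S = 0`), `hd₁` (holomorphy on `{0 < re}`), `hc₁` (continuity in `h`), `hcoef₁`
(`Ec₁ S s h = (∏_{p ∈ P}(s − p)) · fourierCoeffDelta νN β S (E(·; f_s)) h` on `n∕2 < re s`, for EVERY Haar `νN` and covering weight `β` of finite non-zero mass) — and, separately, the lattice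
letters `hmaj₁`∕`hgr₁` (NOT here: surface (u-1b)).  THIS FILE produces `Ec₁` with the first four letters from ★ p861061
`K2LiuSiegelEisensteinRankOneTermPackageCleared.exists_rankOne_package_cleared_of_termData` at `X := H(𝔸)`, `height := adelicHeightGL (n+n)`, HYPOTHESIS-FIRST (exactly as ★ ed. 4a
took its `hfgr`∕`hH` by value): per index `S`, BY VALUE,
* the TERM DATA of ★ p861061 (`ι S` finite; coefficients `a S j`, scalars `ρb S, ρa S, G S`, inner values `Eb S j, Ea S j`, with their holomorphy and monomial-growth letters — the
  (R1-β) Godement exhaustion of the inner section and the (R1-γ) inner Whittaker continuation ★ `K2LiuRankOneInnerWhittakerContinued`, ★ `K2LiuRankOneTermGrowthComparison`);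
* the IDENTIFICATION LETTER `hRK`: on `n∕2 < re s`, for every Haar `νN` and finite non-zero covering weight `β`,
  `fourierCoeffDelta νN β S (E(·; f_s)) h = Σ_j a S j s h · (ρb S s · Eb S j s h + ρa S s · Ea S j s h)` for the rank-one `S` — paid by (R1-α) (★ p861327 `MID_S`, ★ p861405 `W_S`, both as
  corner-line integrals of `f_s` over the SAME transported twist; ★ T3 `fourierCoeffDelta_eisensteinSeriesDelta_of_ne_one`) followed by the (T4) carrier-«A» reading of the two corner-line
  integrals as inner-line Whittaker values of the Godement-exhausted inner section (the one identification not yet in the tree: ★ `K2LiuKlingenTermTwoFourierAdapter` §1 is its start);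
* the CONTINUITY LETTER `hRKc`: `h ↦ fourierCoeffDelta νN β S (E(·; f_s)) h` is continuous on `n∕2 < re s`.
THEN **`exists_kindOne_packages`**: for every finite `P ∋ ½` there is `Ec₁` with ed. 3's `h1off`, `hd₁`, `hc₁`, `hcoef₁` AT THAT `P` — `Ec₁ S := (∏_{p ∈ P ∖ {½}}(s − p)) · E₇^S` on the rank-one
kind (`E₇^S` = ★ p861061's cleared package with `RK := fourierCoeffDelta ν₀ β₀` at a reference pair produced in-file: Haar `ν₀`, ★ (C0) compact cover, ★ covering weight of finite mass,
★ non-zero mass), `Ec₁ S := 0` off kind; the `(νN, β)`-independence required by `hcoef₁` is read off `hRK` (both sides equal the analytic expression).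
References: [Tan1999] §4 Prop. 4.8; [MoeglinWaldspurger1995] II.1.7, IV.1.9–IV.1.11; [KudlaRallis1994] §2; [Shimura1997] §18.3–18.5, Thm. 18.14; [GanQiuTakeda2014] §6.4 Prop. 15.
HONEST LABEL.  Count-neutral helper, hypothesis-first: the identification letter `hRK` is OPEN by name until the (T4)∕(R1-β) seats discharge it; `HC_CM` is proved only modulo the 7
printed citations (2 remaining named inputs: hLiu418 = `stmt-HodgeConjecture-24832`, h413 = `stmt-HodgeConjecture-24833`) until rung 0 closes.
-/

set_option autoImplicit false
set_option linter.dupNamespace false -- the mandated namespace repeats `HodgeConjecture.HodgeConjecture`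

noncomputable section

open scoped Matrix ENNReal NNReal Topology BigOperators
open NumberField IsDedekindDomain MeasureTheory MeasureTheory.Measure Filter Set Function Complex
open Literature.NumberTheory.Automorphic Literature.NumberTheory.Automorphic.UnitaryGroup Literature.NumberTheory.GaloisRepresentations
open Literature.NumberTheory.GelbartRogawski1991 Literature.NumberTheory.GelbartRogawski1991.GRConstruction
open Literature.NumberTheory.K2Lit.SiegelDoubled Literature.MeasureTheory.Group
open UnitaryDualPair

namespace Summit.HodgeConjecture.HodgeConjecture.Cruxes.HLiu418.K2LiuSiegelEisensteinRankOneTermPackageInstance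

open K2LiuSiegelUnipotentFourierDefs K2LiuUnipotentCoveringWeight K2LiuSiegelEisensteinRankOneTermPackageCleared
open K2LiuContinuationPackageAlgebra (exists_height_floor)
open K2LiuUnipotentCocompact (exists_isCompact_cover_unipDelta)
open K2LiuUnipDeltaConjMeasurePreserving (lintegral_ne_zero_of_isCoveringWeight)
open K2LiuSiegelUnipotentHaarPinned (locallyCompactSpace_unipDelta)

variable (L : Type) [Field L] [NumberField L] [IsCMField L]
variable {N M n : ℕ} (e : Fin N × Fin M ≃ Fin n)
  (dV : Fin N → L) (hdV : ∀ i, IsCMField.complexConj L (dV i) = dV i)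
  (dW : Fin M → L) (hdW : ∀ i, IsCMField.complexConj L (dW i) = dW i)

/-- **THE RANK-ONE (KIND 1) TERM PACKAGES OF THE #41 TOP, INSTANTIATED (hypothesis-first).**  See the module docstring: from the TERM DATA of ★ p861061 per index (BY VALUE), the
identification letter `hRK` and the continuity letter `hRKc` on the convergence half-plane `n∕2 < re s` (BY VALUE), for every finite `P ∋ ½`: a family `Ec₁` with ed. 3's letters
`h1off`, `hd₁`, `hc₁`, `hcoef₁` at `P`. [cite: Tan1999, §4 Prop. 4.8] [cite: MoeglinWaldspurger1995, IV.1.9–IV.1.11] [cite: KudlaRallis1994, §2] [cite: Shimura1997, §18.3] -/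
theorem exists_kindOne_packages (hdV0 : ∀ i, dV i ≠ 0) (hdW0 : ∀ i, dW i ≠ 0) (hn : 0 < n)
    [MeasurableSpace (unipDelta L e dV hdV dW hdW)] [BorelSpace (unipDelta L e dV hdV dW hdW)]
    (f : ℂ → HA L e dV hdV dW hdW → ℂ) (P : Finset ℂ) (hP : (1 / 2 : ℂ) ∈ P)
    -- TERM DATA per index (★ p861061's currency at `X := H(𝔸)`, `height := adelicHeightGL (n+n)`)
    (ι : skewMatrices ((IsCMField.complexConj L : L ≃ₐ[Fp L] L) : L →+* L) ((gramR L e dV hdV dW hdW).map (algebraMap (Fp L) L)) → Type) [∀ S, Fintype (ι S)]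
    (a : ∀ S, ι S → ℂ → HA L e dV hdV dW hdW → ℂ)
    (had : ∀ S j x, DifferentiableOn ℂ (fun s => a S j s x) {s : ℂ | 0 < s.re})
    (hag : ∀ S, ∀ z : ℂ, 0 < z.re → ∃ C A r : ℝ, 0 ≤ C ∧ 0 ≤ A ∧ 0 < r ∧ ∀ s : ℂ, dist s z < r → ∀ j x,
      ‖a S j s x‖ ≤ C * adelicHeightGL (n + n) L (x : GL (Fin (n + n)) (AdeleRing (𝓞 L) L)) ^ A)
    (ρb ρa G : skewMatrices ((IsCMField.complexConj L : L ≃ₐ[Fp L] L) : L →+* L) ((gramR L e dV hdV dW hdW).map (algebraMap (Fp L) L)) → ℂ → ℂ)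
    (hρb : ∀ S, DifferentiableOn ℂ (ρb S) {s : ℂ | 0 < s.re})
    (hG : ∀ S, DifferentiableOn ℂ (G S) {s : ℂ | 0 < s.re}) (hGρ : ∀ S, ∀ s : ℂ, 0 < s.re → s ≠ 1 / 2 → G S s = (s - 1 / 2) * ρa S s)
    (Eb Ea : ∀ S, ι S → ℂ → HA L e dV hdV dW hdW → ℂ)
    (hEb : ∀ S j x, DifferentiableOn ℂ (fun s => Eb S j s x) {s : ℂ | 0 < s.re})
    (hEa : ∀ S j x, DifferentiableOn ℂ (fun s => Ea S j s x) {s : ℂ | 0 < s.re})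
    (hbg : ∀ S, ∀ z : ℂ, 0 < z.re → ∃ C A r : ℝ, 0 ≤ C ∧ 0 ≤ A ∧ 0 < r ∧ ∀ s : ℂ, dist s z < r → ∀ j x,
      ‖ρb S s * Eb S j s x‖ ≤ C * adelicHeightGL (n + n) L (x : GL (Fin (n + n)) (AdeleRing (𝓞 L) L)) ^ A)
    (haG : ∀ S, ∀ z : ℂ, 0 < z.re → ∃ C A r : ℝ, 0 ≤ C ∧ 0 ≤ A ∧ 0 < r ∧ ∀ s : ℂ, dist s z < r → ∀ j x,
      ‖G S s * Ea S j s x‖ ≤ C * adelicHeightGL (n + n) L (x : GL (Fin (n + n)) (AdeleRing (𝓞 L) L)) ^ A)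
    -- THE IDENTIFICATION LETTER ((R1-α) ★ + (T4)∕(R1-β)∕(R1-γ)) and the continuity letter, on the convergence half-plane
    (hRK : ∀ S : skewMatrices ((IsCMField.complexConj L : L ≃ₐ[Fp L] L) : L →+* L) ((gramR L e dV hdV dW hdW).map (algebraMap (Fp L) L)),
      (S : Matrix (Fin n) (Fin n) L) ≠ 0 → (S : Matrix (Fin n) (Fin n) L).det = 0 →
      ∀ (νN : Measure (unipDelta L e dV hdV dW hdW)) [νN.IsHaarMeasure] (β : unipDelta L e dV hdV dW hdW → ℝ≥0∞),
      IsCoveringWeight (unipDeltaRat L e dV hdV dW hdW) β → ∫⁻ u, β u ∂νN ≠ 0 → ∫⁻ u, β u ∂νN ≠ ∞ →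
      ∀ (s : ℂ) (h : HA L e dV hdV dW hdW), (n : ℝ) / 2 < s.re →
        fourierCoeffDelta L e dV hdV dW hdW νN β (S : Matrix (Fin n) (Fin n) L) (eisensteinFamilyDelta L e dV hdV dW hdW f s) h =
          ∑ j, a S j s h * (ρb S s * Eb S j s h + ρa S s * Ea S j s h))
    (hRKc : ∀ S : skewMatrices ((IsCMField.complexConj L : L ≃ₐ[Fp L] L) : L →+* L) ((gramR L e dV hdV dW hdW).map (algebraMap (Fp L) L)),
      ∀ (νN : Measure (unipDelta L e dV hdV dW hdW)) [νN.IsHaarMeasure] (β : unipDelta L e dV hdV dW hdW → ℝ≥0∞),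
      IsCoveringWeight (unipDeltaRat L e dV hdV dW hdW) β → ∫⁻ u, β u ∂νN ≠ 0 → ∫⁻ u, β u ∂νN ≠ ∞ →
      ∀ s : ℂ, (n : ℝ) / 2 < s.re →
        Continuous fun h : HA L e dV hdV dW hdW => fourierCoeffDelta L e dV hdV dW hdW νN β (S : Matrix (Fin n) (Fin n) L) (eisensteinFamilyDelta L e dV hdV dW hdW f s) h) :
    ∃ Ec₁ : skewMatrices ((IsCMField.complexConj L : L ≃ₐ[Fp L] L) : L →+* L) ((gramR L e dV hdV dW hdW).map (algebraMap (Fp L) L)) → ℂ → HA L e dV hdV dW hdW → ℂ,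
      (∀ S : skewMatrices ((IsCMField.complexConj L : L ≃ₐ[Fp L] L) : L →+* L) ((gramR L e dV hdV dW hdW).map (algebraMap (Fp L) L)), ¬ ((S : Matrix (Fin n) (Fin n) L) ≠ 0 ∧ (S : Matrix (Fin n) (Fin n) L).det = 0) → ∀ s h, Ec₁ S s h = 0) ∧
      (∀ (S : skewMatrices ((IsCMField.complexConj L : L ≃ₐ[Fp L] L) : L →+* L) ((gramR L e dV hdV dW hdW).map (algebraMap (Fp L) L))) (h : HA L e dV hdV dW hdW), DifferentiableOn ℂ (fun s => Ec₁ S s h) {s : ℂ | 0 < s.re}) ∧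
      (∀ (S : skewMatrices ((IsCMField.complexConj L : L ≃ₐ[Fp L] L) : L →+* L) ((gramR L e dV hdV dW hdW).map (algebraMap (Fp L) L))) (s : ℂ), 0 < s.re → Continuous (Ec₁ S s)) ∧
      (∀ (νN : Measure (unipDelta L e dV hdV dW hdW)) [νN.IsHaarMeasure] (β : unipDelta L e dV hdV dW hdW → ℝ≥0∞),
        IsCoveringWeight (unipDeltaRat L e dV hdV dW hdW) β → ∫⁻ u, β u ∂νN ≠ 0 → ∫⁻ u, β u ∂νN ≠ ∞ →
        ∀ S : skewMatrices ((IsCMField.complexConj L : L ≃ₐ[Fp L] L) : L →+* L) ((gramR L e dV hdV dW hdW).map (algebraMap (Fp L) L)), (S : Matrix (Fin n) (Fin n) L) ≠ 0 → (S : Matrix (Fin n) (Fin n) L).det = 0 →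
        ∀ (s : ℂ) (h : HA L e dV hdV dW hdW), (n : ℝ) / 2 < s.re →
          Ec₁ S s h = (∏ p ∈ P, (s - p)) * fourierCoeffDelta L e dV hdV dW hdW νN β (S : Matrix (Fin n) (Fin n) L) (eisensteinFamilyDelta L e dV hdV dW hdW f s) h) := by
  classical
  haveI : NeZero (n + n) := ⟨by omega⟩
  -- the height on `H(𝔸)`: positive, bounded on compacts, with a floor
  have hpos : ∀ x : HA L e dV hdV dW hdW, 0 < adelicHeightGL (n + n) L (x : GL (Fin (n + n)) (AdeleRing (𝓞 L) L)) := fun x => adelicHeightGL_pos_holds _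
  have hcpt : ∀ K : Set (HA L e dV hdV dW hdW), IsCompact K → ∃ B : ℝ, ∀ x ∈ K, adelicHeightGL (n + n) L (x : GL (Fin (n + n)) (AdeleRing (𝓞 L) L)) ≤ B := by
    intro K hK
    obtain ⟨B, -, hB⟩ := exists_adelicHeightGL_le_of_isCompact (n := n + n) (K := L) (hK.image continuous_subtype_val)
    exact ⟨B, fun x hx => hB _ (Set.mem_image_of_mem _ hx)⟩
  obtain ⟨m, hm, hfloor⟩ := exists_height_floor L e dV hdV dW hdW hn
  -- a reference pair: a Haar measure `ν₀` on `N_Δ(𝔸)` and an `N_Δ(L⁺)`-covering weight of finite non-zero mass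
  haveI : LocallyCompactSpace (unipDelta L e dV hdV dW hdW) := locallyCompactSpace_unipDelta L e dV hdV dW hdW
  haveI : Countable (unipDeltaRat L e dV hdV dW hdW) := countable_unipDeltaRat L e dV hdV dW hdW
  obtain ⟨K, hKc, hKcov⟩ := exists_isCompact_cover_unipDelta L e dV hdV dW hdW hdV0 hdW0
  obtain ⟨β₀, hβ₀, -, -, hβ₀top⟩ := exists_isCoveringWeight_unipDeltaRat_lintegral_ne_top L e dV hdV dW hdW (Measure.haar : Measure (unipDelta L e dV hdV dW hdW)) hKc hKcov
  have hβ₀0 : ∫⁻ u, β₀ u ∂(Measure.haar : Measure (unipDelta L e dV hdV dW hdW)) ≠ 0 :=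
    lintegral_ne_zero_of_isCoveringWeight _ (NeZero.ne _) (unipDeltaRat L e dV hdV dW hdW) hβ₀
  -- the convergence half-plane `c = n∕2 ≥ ½`
  have hc : (1 : ℝ) / 2 ≤ (n : ℝ) / 2 := by
    have : (1 : ℝ) ≤ n := by exact_mod_cast hn
    linarith
  -- the cleared package of ★ p861061 for each rank-one index, at the reference pair
  have hpkg : ∀ S : skewMatrices ((IsCMField.complexConj L : L ≃ₐ[Fp L] L) : L →+* L) ((gramR L e dV hdV dW hdW).map (algebraMap (Fp L) L)),
      (S : Matrix (Fin n) (Fin n) L) ≠ 0 ∧ (S : Matrix (Fin n) (Fin n) L).det = 0 →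
      ∃ E₇ : ℂ → HA L e dV hdV dW hdW → ℂ,
        (∀ x, DifferentiableOn ℂ (fun s => E₇ s x) {s : ℂ | 0 < s.re}) ∧
        (∀ s : ℂ, 0 < s.re → Continuous (E₇ s)) ∧
        (∀ (s : ℂ) (x : HA L e dV hdV dW hdW), (n : ℝ) / 2 < s.re → E₇ s x = (∏ p ∈ ({1 / 2} : Finset ℂ), (s - p)) *
          fourierCoeffDelta L e dV hdV dW hdW Measure.haar β₀ (S : Matrix (Fin n) (Fin n) L) (eisensteinFamilyDelta L e dV hdV dW hdW f s) x) ∧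
        (∀ z : ℂ, 0 < z.re → ∃ C A r : ℝ, 0 < r ∧ ∀ s : ℂ, dist s z < r → ∀ x,
          ‖E₇ s x‖ ≤ C * adelicHeightGL (n + n) L (x : GL (Fin (n + n)) (AdeleRing (𝓞 L) L)) ^ A) := by
    intro S hS
    exact exists_rankOne_package_cleared_of_termData (fun x : HA L e dV hdV dW hdW => adelicHeightGL (n + n) L (x : GL (Fin (n + n)) (AdeleRing (𝓞 L) L)))
      hpos hcpt hm hfloor (a S) (had S) (hag S) (ρb S) (hρb S) (Eb S) (hEb S) (ρa S) (G S) (hG S) (hGρ S) (Ea S) (hEa S) (hbg S) (haG S) hc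
      (fun s x => fourierCoeffDelta L e dV hdV dW hdW Measure.haar β₀ (S : Matrix (Fin n) (Fin n) L) (eisensteinFamilyDelta L e dV hdV dW hdW f s) x)
      (fun s hs => hRKc S Measure.haar β₀ hβ₀ hβ₀0 hβ₀top s hs) (fun s x hs => hRK S hS.1 hS.2 Measure.haar β₀ hβ₀ hβ₀0 hβ₀top s x hs)
  choose E₇ hE₇d hE₇c hE₇eq _hE₇g using hpkg
  -- the packages: `(∏_{P ∖ {½}}(s − p)) · E₇^S` on the rank-one kind, `0` off kind
  refine ⟨fun S s h => if hS : (S : Matrix (Fin n) (Fin n) L) ≠ 0 ∧ (S : Matrix (Fin n) (Fin n) L).det = 0 then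
      (∏ p ∈ P.erase (1 / 2), (s - p)) * E₇ S hS s h else 0, ?_, ?_, ?_, ?_⟩
  · intro S hS s h
    simp only [dif_neg hS]
  · intro S h
    by_cases hS : (S : Matrix (Fin n) (Fin n) L) ≠ 0 ∧ (S : Matrix (Fin n) (Fin n) L).det = 0
    · simp only [dif_pos hS]
      exact (DifferentiableOn.fun_finsetProd fun p _ => differentiableOn_id.sub_const p).mul (hE₇d S hS h)
    · simp only [dif_neg hS]
      exact differentiableOn_const 0
  · intro S s hs
    by_cases hS : (S : Matrix (Fin n) (Fin n) L) ≠ 0 ∧ (S : Matrix (Fin n) (Fin n) L).det = 0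
    · simp only [dif_pos hS]
      exact continuous_const.mul (hE₇c S hS s hs)
    · simp only [dif_neg hS]
      exact continuous_const
  · intro νN _ β hβ hβ0 hβtop S hS0 hSdet s h hs
    have hS : (S : Matrix (Fin n) (Fin n) L) ≠ 0 ∧ (S : Matrix (Fin n) (Fin n) L).det = 0 := ⟨hS0, hSdet⟩
    simp only [dif_pos hS]
    -- the reference coefficient equals the `(νN, β)`-coefficient: both are the analytic expression of `hRK`
    have hindep : fourierCoeffDelta L e dV hdV dW hdW Measure.haar β₀ (S : Matrix (Fin n) (Fin n) L) (eisensteinFamilyDelta L e dV hdV dW hdW f s) h =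
        fourierCoeffDelta L e dV hdV dW hdW νN β (S : Matrix (Fin n) (Fin n) L) (eisensteinFamilyDelta L e dV hdV dW hdW f s) h := by
      rw [hRK S hS0 hSdet Measure.haar β₀ hβ₀ hβ₀0 hβ₀top s h hs, hRK S hS0 hSdet νN β hβ hβ0 hβtop s h hs]
    have hs0 : 0 < s.re := lt_of_le_of_lt (by positivity) hs
    rw [hE₇eq S hS s h hs, Finset.prod_singleton, hindep, ← mul_assoc, Finset.prod_erase_mul P (fun p => s - p) hP]

end Summit.HodgeConjecture.HodgeConjecture.Cruxes.HLiu418.K2LiuSiegelEisensteinRankOneTermPackageInstance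

end
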